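/-
Copyright: the b2b-balaban T⁴-continuum CRUX team, row NE7b OWNER lineage `t4-ne7b-p1` (gen 126). Project licence.
-/
import Summits.QuantumFields.BalabanUV.T4Continuum.Spine.NE7b.SupZdCouplingTransferSolvability

/-!
# THE REST OF THE PACKAGE AT A SHIFTED COUPLING: on `ℤ^d`, for the `H + K` column, (i) a fluctuation part `w = C_af` of the reference
# coupling IS a fluctuation part at every coupling `a′` with the SAME coarse remainder (`Πw = 0`), (ii) a response kernel `h = h^a_{b₀}`
# IS a response kernel at `a′` with the coarse datum shifted by `(a′−a)e_{b₀}` (`Πh = e_{b₀}∘blk`), and (iii) a decaying two-sided inverse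
# of the coarse matrix at `a′` is the ONLY decaying right (or left) inverse there ((222) (C5)'s clause at `a′`, by (217)'s
# left-inverse = right-inverse) — so after (264)'s window step EVERY clause of (246)'s one-stop at the shifted coupling is available
# from the reference coupling, with the response and the covariance literally unchanged (row NE7b, node U5c; (217)∕(260)∕(264) BY NAME;
# [folklore])

Cell `pub-balaban`, sub-cell `t4`, spine estimate NE7b (`T4WeightBudget.RelWeightBound`; the cell's OWN estimate — NOT PRINTED in
[Bałaban 1983–89], NOT PROVED).  Crux-route work under `Spine/NE7b/` by the row OWNER (`t4-ne7b-p1` gen 126, file (267)) under FREEZE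
(0)'s crux-prover clause, on § [NE7bP1-G125-HANDOFF] NEXT (3)(a); NOTHING of Bałaban's is named as a Lean object, valued or asserted; no
`T4Continuum/Support` leaf typed; no `def`, no notation (all objects are ANY data with the displayed clauses); zero `sorry`.  Imports (BY
NAME): the OWNER's (263) `…SupZdCouplingTransferSolvability` (import closure: (217) `left_inverse_eq_right_inverse`, (234) `coarse_entry_le`,
(189) `summable_kernel_row`).

WHY (located).  (260) proved that fluctuation parts and response kernels at two couplings COINCIDE when both exist; (264) produces the
columns, solvability, uniqueness and the two-sided inverse at `a′`.  What a consumer of (246)-style clauses at `a′` still wants is the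
EXISTENCE of the response and covariance objects at `a′` with their displays, and (C5)'s uniqueness of the inverse.  Existence is free:
the `a`-objects themselves satisfy the `a′`-displays, because `H_{V,a′} − H_{V,a} = (a′−a)Π` sees a fluctuation part not at all and a
response kernel only through its prescribed block means (§1, §2 — the one-line computations used inside (260), exported).  (C5) at `a′`
follows from (264)'s two-sided `N + (a′−a)·1` and (217): a decaying right inverse equals any decaying left inverse (§3).

WHAT IS PROVED ([folklore]; every mesh `n`, ANY `a, a′`, `V`, kernel `K` with convergent rows on bounded functions):
* §1 **`fluctuation_part_at_shifted_coupling`** (`Q′w = 0`, `(H_{V,a} + K)w = g` ⟹ `(H_{V,a′} + K)w = g`).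
* §2 **`response_at_shifted_coupling`** (`Q′h = e_{b₀}`, `(H_{V,a} + K)h = m∘blk` ⟹ `(H_{V,a′} + K)h = (m + (a′−a)e_{b₀})∘blk`).
* §3 THE END **`inverse_unique_at_shifted_coupling`** (columns `Ψ′` of block profile, a decaying `N′` with `N′T′ = 1`: every decaying
  right inverse `N″` of `T′` equals `N′`; and with `T′N′ = 1`, every decaying left inverse equals `N′`).
* §4 toy.

HONEST (what this is NOT).  One-line algebra and (217) by name; nothing is constructed here; scalar skeleton ((A3), NC-NE7b-α UNRULED);
nothing of the torus; nothing of the covariant propagators of [B4]–[B6]; nothing of Bałaban's asserted.  BY-NAME EFFECT ON THE WALL: NONE.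
NE7b NOT PRINTED ∕ NOT PROVED; spine PROVED 0∕9; rung (B)+1 — the programme's measures remain FINITE-torus statements; NOT the mass gap,
NOT Clay.  HONEST DEPENDENCY: continuum YM on T⁴ ⇐ BetaPertH ∧ nine spine estimates (0∕9 proved); BetaPertH ⇐ (D1) ∧ (D4) ∧ CAP+tail;
G-an2-4 gates asym, D1 and NE2∕3∕4.
-/

set_option autoImplicit false

noncomputable section

namespace Summit.QuantumFields.BalabanUV.T4Continuum.NE7b.SupZdCouplingWindowObjects

open Real Filter Topology
open Literature.MathematicalPhysics.QuantumFieldTheory.Balaban1983to89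
open B6QGQLower276 (X e blk B mem_B sum_B_const)
open SupZdPerturbedCoarseForm (coarse_entry_le)
open SupZdKernelNeumann (left_inverse_eq_right_inverse)

variable {d : ℕ}

/-! ## §1. A fluctuation part does not see the coupling -/

/-- **`C_af` IS A FLUCTUATION PART AT EVERY COUPLING**: if `w` has vanishing block means and `(H_{V,a} + K)w = g` pointwise, then
`(H_{V,a′} + K)w = g` pointwise for every `a′` — the coupling term is `a′·(block mean of w) = 0`. [folklore] -/
theorem fluctuation_part_at_shifted_coupling (n : ℕ) (a a' : ℝ) (V : X d → ℝ) (K : X d → X d → ℝ) (w g : X d → ℝ)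
    (hQw : ∀ b, (((n : ℝ) + 1) ^ d)⁻¹ * ∑ q ∈ B n b, w q = 0)
    (hHw : ∀ p, ((n : ℝ) + 1) ^ 2 * ∑ μ', (2 * w p - w (p + e μ') - w (p - e μ'))
        + a / ((n : ℝ) + 1) ^ d * ∑ q ∈ B n (blk n p), w q + V p * w p + ∑' q : X d, K p q * w q = g p) (p : X d) :
    ((n : ℝ) + 1) ^ 2 * ∑ μ', (2 * w p - w (p + e μ') - w (p - e μ'))
        + a' / ((n : ℝ) + 1) ^ d * ∑ q ∈ B n (blk n p), w q + V p * w p + ∑' q : X d, K p q * w q = g p := by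
  have hvol : (0 : ℝ) < ((n : ℝ) + 1) ^ d := by positivity
  have hPi : ∑ q ∈ B n (blk n p), w q = 0 := by
    have h := hQw (blk n p)
    rcases mul_eq_zero.1 h with h1 | h1
    · exact absurd h1 (inv_ne_zero hvol.ne')
    · exact h1
  rw [← hHw p, hPi, mul_zero, mul_zero]

/-! ## §2. A response kernel sees the coupling only through its block means -/

/-- **`h^a_{b₀}` IS A RESPONSE KERNEL AT EVERY COUPLING**: if `Q′h = e_{b₀}` and `(H_{V,a} + K)h = m∘blk`, then
`(H_{V,a′} + K)h = (m + (a′−a)e_{b₀})∘blk`. [folklore] -/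
theorem response_at_shifted_coupling (n : ℕ) (a a' : ℝ) (V : X d → ℝ) (K : X d → X d → ℝ) (b₀ : X d) (h m : X d → ℝ)
    (hQh : ∀ b, (((n : ℝ) + 1) ^ d)⁻¹ * ∑ q ∈ B n b, h q = if b = b₀ then 1 else 0)
    (hHh : ∀ p, ((n : ℝ) + 1) ^ 2 * ∑ μ', (2 * h p - h (p + e μ') - h (p - e μ'))
        + a / ((n : ℝ) + 1) ^ d * ∑ q ∈ B n (blk n p), h q + V p * h p + ∑' q : X d, K p q * h q = m (blk n p)) (p : X d) :
    ((n : ℝ) + 1) ^ 2 * ∑ μ', (2 * h p - h (p + e μ') - h (p - e μ'))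
        + a' / ((n : ℝ) + 1) ^ d * ∑ q ∈ B n (blk n p), h q + V p * h p + ∑' q : X d, K p q * h q
      = m (blk n p) + (a' - a) * (if blk n p = b₀ then 1 else 0) := by
  rw [← hHh p, ← hQh (blk n p), div_eq_mul_inv, div_eq_mul_inv]
  ring

/-! ## §3. THE END: the inverse of the coarse matrix at the shifted coupling is unique in the decaying class -/

/-- **HEADLINE — (C5) AT THE SHIFTED COUPLING.**  Columns `Ψ′` of block profile `C_Ψ′` (their coarse matrix `T′(b,c) = (n+1)^{−d}Σ_{B b}Ψ′_c` is
then bounded by `C_Ψ′`) and a decaying `N′` ((264)'s `N + (a′−a)·1`): if `N′T′ = 1` then every decaying RIGHT inverse `N″` of `T′` equals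
`N′`; if `T′N′ = 1` then every decaying LEFT inverse equals `N′` — (217)'s left-inverse = right-inverse. [folklore] -/
theorem inverse_unique_at_shifted_coupling (n : ℕ) {μ CΨ' CN νN : ℝ} (hμ : 0 < μ) (hνN : 0 < νN)
    (Ψ' : X d → X d → ℝ) (hΨ'd : ∀ c p, |Ψ' c p| ≤ CΨ' * exp (-(μ * ∑ i, (((blk n p i - c i).natAbs : ℕ) : ℝ))))
    (N' : X d → X d → ℝ) (hN'd : ∀ b c, |N' b c| ≤ CN * exp (-(νN * ∑ i, (((b i - c i).natAbs : ℕ) : ℝ)))) :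
    ((∀ c b, ∑' b' : X d, N' c b' * ((((n : ℝ) + 1) ^ d)⁻¹ * ∑ q ∈ B n b', Ψ' b q) = if c = b then 1 else 0) →
      ∀ (N'' : X d → X d → ℝ) (C'' ν'' : ℝ), 0 ≤ C'' → 0 < ν'' →
        (∀ b c, |N'' b c| ≤ C'' * exp (-(ν'' * ∑ i, (((b i - c i).natAbs : ℕ) : ℝ)))) →
        (∀ b c, ∑' b' : X d, ((((n : ℝ) + 1) ^ d)⁻¹ * ∑ q ∈ B n b, Ψ' b' q) * N'' b' c = if b = c then 1 else 0) →
        ∀ b c, N'' b c = N' b c) ∧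
    ((∀ b c, ∑' b' : X d, ((((n : ℝ) + 1) ^ d)⁻¹ * ∑ q ∈ B n b, Ψ' b' q) * N' b' c = if b = c then 1 else 0) →
      ∀ (N'' : X d → X d → ℝ) (C'' ν'' : ℝ), 0 ≤ C'' → 0 < ν'' →
        (∀ b c, |N'' b c| ≤ C'' * exp (-(ν'' * ∑ i, (((b i - c i).natAbs : ℕ) : ℝ)))) →
        (∀ c b, ∑' b' : X d, N'' c b' * ((((n : ℝ) + 1) ^ d)⁻¹ * ∑ q ∈ B n b', Ψ' b q) = if c = b then 1 else 0) →
        ∀ b c, N'' b c = N' b c) := by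
  classical
  have hCΨ' : 0 ≤ CΨ' := by
    have h := (abs_nonneg _).trans (hΨ'd 0 0); exact le_of_mul_le_mul_right (by rw [zero_mul]; exact h) (exp_pos _)
  have hCN : 0 ≤ CN := by
    have h := (abs_nonneg _).trans (hN'd 0 0); exact le_of_mul_le_mul_right (by rw [zero_mul]; exact h) (exp_pos _)
  -- the coarse matrix is bounded
  obtain ⟨T, hT⟩ : ∃ T : X d → X d → ℝ, ∀ b c, T b c = (((n : ℝ) + 1) ^ d)⁻¹ * ∑ q ∈ B n b, Ψ' c q := ⟨_, fun _ _ => rfl⟩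
  have hTb : ∀ b c, |T b c| ≤ CΨ' := fun b c => by
    rw [hT]
    exact (coarse_entry_le n Ψ' c (hΨ'd c) b).trans (mul_le_of_le_one_right hCΨ' (exp_le_one_iff.2 (neg_nonpos.2 (by positivity))))
  refine ⟨fun hleft N'' C'' ν'' hC'' hν'' hN''d hN''right b c => ?_, fun hright N'' C'' ν'' hC'' hν'' hN''d hN''left b c => ?_⟩
  · -- `N′` is a left inverse, `N″` a right inverse ⟹ `N′ = N″`
    have hAN : ∀ b c, ∑' b' : X d, T b b' * N'' b' c = if b = c then 1 else 0 := fun b c => by simp only [hT]; exact hN''right b c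
    have hLA : ∀ b c, ∑' b' : X d, N' b b' * T b' c = if b = c then 1 else 0 := fun b c => by simp only [hT]; exact hleft b c
    exact (left_inverse_eq_right_inverse hCN hνN hCΨ' hC'' hν'' T N' N'' hTb hN'd hN''d hAN hLA b c).symm
  · -- `N″` is a left inverse, `N′` a right inverse ⟹ `N″ = N′`
    have hAN : ∀ b c, ∑' b' : X d, T b b' * N' b' c = if b = c then 1 else 0 := fun b c => by simp only [hT]; exact hright b c
    have hLA : ∀ b c, ∑' b' : X d, N'' b b' * T b' c = if b = c then 1 else 0 := fun b c => by simp only [hT]; exact hN''left b c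
    exact left_inverse_eq_right_inverse hC'' hν'' hCΨ' hCN hνN T N'' N' hTb hN''d hN'd hAN hLA b c

/-! ## §4. Toy -/

/-- Toy (`d = 1`, `n = 0`): a fluctuation part of the zero field is one at every coupling (§1 with everything zero). -/
example (a a' : ℝ) (p : X 1) :
    (((0 : ℕ) : ℝ) + 1) ^ 2 * ∑ μ', (2 * (fun _ : X 1 => (0 : ℝ)) p - (fun _ : X 1 => (0 : ℝ)) (p + e μ')
        - (fun _ : X 1 => (0 : ℝ)) (p - e μ'))
      + a' / (((0 : ℕ) : ℝ) + 1) ^ 1 * ∑ q ∈ B 0 (blk 0 p), (fun _ : X 1 => (0 : ℝ)) q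
      + (fun _ : X 1 => (0 : ℝ)) p * (fun _ : X 1 => (0 : ℝ)) p + ∑' q : X 1, (fun _ _ : X 1 => (0 : ℝ)) p q * (fun _ : X 1 => (0 : ℝ)) q
      = (fun _ : X 1 => (0 : ℝ)) p :=
  fluctuation_part_at_shifted_coupling (d := 1) 0 a a' (fun _ => 0) (fun _ _ => 0) (fun _ => 0) (fun _ => 0) (fun _ => by simp)
    (fun _ => by simp) p

end Summit.QuantumFields.BalabanUV.T4Continuum.NE7b.SupZdCouplingWindowObjects
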